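import Summits.HubbardSuperconductivity.HubbardSuperconductivity.Theorems.KLProgrammeKLRegimeScaleZeroCovarianceOffSiteProfileBridge
import Summits.HubbardSuperconductivity.HubbardSuperconductivity.Theorems.KLProgrammeKLRegimeScaleZeroBetaWindowGridSum

/-!
# Route `KLProgramme`, crux K3 — engine-flow child (stmt-HubbardSuperconductivity-20437 `KLRegimeEngineV17F2`), stub (C) at `n = 0`,
# located item #22a «(C)-SCALE0-PT2»: THE RECORD FORMAT, V2 — `SunsetCellRecordV2` / `ScaleZeroSunsetCertV2` (octave table kit-internal)

Seat hubbard-kl-k3c5-p1 (g14; owner of #22a).  **V2 of `…FlowReadScaleZeroSunsetCertDefs` (p628458)** after the float pass j306375 (KL STATUS 11:5xZ): the octave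
table needs `N ≳ 2·10³` s-cells (a 64-cell SUP table is ×17/×10/×3.6 loose at k = 0/1/2 because |C(x,t)| varies on the t-scale 1 near t = 0⁺, β⁻), i.e. 10⁵–10⁶ rationals —
not a Lean literal.  So V2 keeps in the record ONLY what Lean reads (μ-cell, disk radius, the three certified ROW TOTALS) and moves the octave table, like the profiles,
into the EXISTENTIAL part of the Prop (certified kit-side, two implementations).  V1 stays valid for small tables; the reader targets V2.  What ONE run of KIT JOB A (SCALE0-PT2-CERT-SPEC v2.1 Δ6; two interval-arithmetic implementations) delivers for
ONE μ-cell, in the pattern of `…CountertermJacksonRemainderCertFrameDefs.CutoffDefectCertFrame`: a small RECORD of rationals that a Lean file can hold (the μ-cell, the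
certified disk radius and the three row totals) and a PROP stating what the kit certified about it — the (huge) profile tables themselves stay in
the kit artifact and enter the Prop EXISTENTIALLY:

`ScaleZeroSunsetCertV2 c` :⟺ there are `K, N ≥ 1`, a table `tab : Fin 3 → ℕ → ℕ → ℝ≥0∞` and measurable profiles `P z : ℝ → ℝ≥0∞` (`z ∈ ℤ²`, `0 < ‖z‖∞ ≤ Rc`) such that
* (i) FATTENED PROFILE DOMINATION of the β = ∞ off-site kernel, uniformly on the cell: for `μ ∈ [μlo, μhi]`, `z` in the punctured disk and `|u − t| ≤ 2⁻¹⁰`,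
  `‖(1/2π)·𝓕(G_{μ,z})(u/2π)‖₊ ≤ P z t`, where `G_{μ,z}(ω) = mFourierCoeff (descend (y ↦ Ψ(1, Λ₀; e₀(2πy), ω))) (−z)` is EXACTLY the kernel of p1 g20's door
  `enorm_gridCov_offSite_le_tsum_profile` (hypothesis `hp`), and the fattening radius `2⁻¹⁰` exceeds every grid step `β/4M ≤ 2⁻¹²/β` at `M ≥ klEngM₃`
  (`…ScaleZeroBetaWindowGridSum.tsum_profile_le_of_fattened`);
* (ii) OCTAVE-TABLE DOMINATION: on (β-cell `i` of `[β₀, 2β₀]`, `β₀ = klBetaMin`) × (s-cell `j`), the SITE-SUMMED, WEIGHTED sunset shape of the profiles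
  `Σ_{z} w_k(z)·(Σ_m P z (β(s+m)))²·(Σ_m P (−z) (β(1−s+m)))` is `≤ tab k i j` (weights `w₀ = 1`, `w₁ = ‖z‖₂`, `w₂ = ‖z‖₂²` — the assembly's `hS0`/`hS1`/`hS2`) — the hypothesis
  `hM` of `sunsetShape_le_of_octaveTable` (D6) / `sunsetShape_gridSum_le_of_octaveTable` (β1);
* (iii) ROW TOTALS: `β₀(1+(i+1)/K)·Σ_j tab k i j/N ≤ row k` (the `hS` of D6).
The READER (`…SunsetCertReader`, next) proves `ScaleZeroSunsetCertV2 c →` the rows `hS0/hS1/hS2` of `twoLegRead_frameZero_of_sunsetData` with `bS_k := 2·row k + (tails)` for every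
`μ ∈ cell`, `β ≥ klBetaMin`, `L ≥ klEngL₃`, `M ≥ klEngM₃`; the five fits then read `row k` against the targets 0.04 / 0.16 / 1.0 by `norm_num`.

Definitions only (+ two unfolding lemmas); nothing here asserts (C), any stub of 20437, K3 or superconductivity; no certificate is claimed.
References: BGM 2006 §2.3–§2.4 [cite: BenfattoGiulianiMastropietro2006].
-/

noncomputable section

namespace Summit.HubbardSuperconductivity.HubbardSuperconductivity.Theorems.KLRegimeSplit

set_option linter.dupNamespace false -- summit = problem name (single-conjunct summit), D-0017

open Literature.MathematicalPhysics.QuantumLattice Literature.Probability.LatticeModels Literature.Analysis.FunctionSpaces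
open Summit.HubbardSuperconductivity.HubbardSuperconductivity.Theorems.DispersionFlow
open MeasureTheory Set Finset Complex UnitAddTorus Real
open scoped FourierTransform Nat ENNReal NNReal

/-- **The record of one μ-cell certificate, V2** (all numbers rational; written by `gen_record.py`; profiles AND octave table are NOT in the record). -/
structure SunsetCellRecordV2 where
  /-- the μ-cell `[μlo, μhi]` -/
  μlo : ℚ
  /-- the μ-cell `[μlo, μhi]` -/
  μhi : ℚ
  /-- certified punctured disk: sites `z ∈ ℤ²` with `0 < ‖z‖∞ ≤ Rc` -/
  Rc : ℕ
  /-- certified row totals `row k ≥ max_i klBetaMin(1+(i+1)/K)·Σ_j tab k i j / N` of the (kit-internal) octave table -/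
  row : Fin 3 → ℚ

namespace SunsetCellRecordV2

/-- The certified punctured disk `{z : 0 < ‖z‖∞ ≤ Rc}` as a finset of `ℤ²`. -/
def disk (c : SunsetCellRecordV2) : Finset (Fin 2 → ℤ) :=
  (Fintype.piFinset fun _ : Fin 2 => Finset.Icc (-(c.Rc : ℤ)) c.Rc).filter (· ≠ 0)

/-- The site weights of the three certified rows: `1`, `‖z‖₂`, `‖z‖₂²` (as `ℝ≥0∞`). -/
def siteWeight (k : Fin 3) (z : Fin 2 → ℤ) : ℝ≥0∞ :=
  ENNReal.ofReal (Real.sqrt (((z 0 : ℝ)) ^ 2 + ((z 1 : ℝ)) ^ 2) ^ (k : ℕ))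

/-- Membership in the disk, unfolded. -/
theorem mem_disk (c : SunsetCellRecordV2) (z : Fin 2 → ℤ) :
    z ∈ c.disk ↔ (∀ j, -(c.Rc : ℤ) ≤ z j ∧ z j ≤ c.Rc) ∧ z ≠ 0 := by
  simp [disk, Fintype.mem_piFinset]

/-- The weight of row `0` is `1`. -/
theorem siteWeight_zero (z : Fin 2 → ℤ) : siteWeight 0 z = 1 := by
  simp [siteWeight]

end SunsetCellRecordV2

/-- **`ScaleZeroSunsetCertV2 c`** — what KIT JOB A certifies for the μ-cell record `c` (module docstring (i)–(iii)); a named hypothesis of the reader, discharged by the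
compute certificate (job manifest + two implementations), never inside Lean.  Octave parameters `K, N`, the table `tab` and the profiles `P` are existential. -/
def ScaleZeroSunsetCertV2 (c : SunsetCellRecordV2) : Prop :=
  ∃ (K N : ℕ) (tab : Fin 3 → ℕ → ℕ → ℝ≥0∞) (P : (Fin 2 → ℤ) → ℝ → ℝ≥0∞), 0 < K ∧ 0 < N ∧ (∀ z, Measurable (P z)) ∧
    -- (i) fattened profile domination of the β = ∞ off-site kernel, uniformly on the μ-cell
    (∀ μ : ℝ, (c.μlo : ℝ) ≤ μ → μ ≤ c.μhi → ∀ z ∈ c.disk, ∀ t u : ℝ, |u - t| ≤ (2 : ℝ)⁻¹ ^ 10 →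
      (‖((1 / (2 * π) : ℝ) : ℂ) * 𝓕 (fun om : ℝ => mFourierCoeff (Torus.descend
          (fun y : Momentum => uvSymbolFn 1 klE0 (frameLevel μ 0 ((2 * π) • y)) om) (uvSpatialSymbol_isLatticePeriodic 1 klE0 μ 0 om))
          (-z)) (u / (2 * π))‖₊ : ℝ≥0∞) ≤ P z t) ∧
    -- (ii) octave-table domination of the site-summed weighted sunset shapes of the profiles
    (∀ k : Fin 3, ∀ i : ℕ, i < K → ∀ j : ℕ, j < N → ∀ β : ℝ, klBetaMin * (1 + (i : ℝ) / K) ≤ β → β ≤ klBetaMin * (1 + ((i : ℝ) + 1) / K) →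
      ∀ s : ℝ, (j : ℝ) / N < s → s ≤ ((j : ℝ) + 1) / N →
        ∑ z ∈ c.disk, SunsetCellRecordV2.siteWeight k z *
          ((∑' m : ℤ, P z (β * (s + m))) ^ 2 * (∑' m : ℤ, P (-z) (β * (1 - s + m)))) ≤ tab k i j) ∧
    -- (iii) row totals
    (∀ k : Fin 3, ∀ i : ℕ, i < K →
      ENNReal.ofReal (klBetaMin * (1 + ((i : ℝ) + 1) / K)) * ∑ j ∈ Finset.range N, ENNReal.ofReal (1 / (N : ℝ)) * tab k i j ≤
        ENNReal.ofReal (c.row k : ℝ))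

/-! ## §V3 (appended, same seat, after the reader design pass — KL STATUS 2026-08-28 12:58Z «TAILS-IN-TABLE»)

The profile door adds a constant TAIL `T` (Matsubara-window tail + torus tail) to each of the three covariance factors, `‖A‖₊ ≤ E_z(u) + T`, and
`(E₁ + T)²(E₂ + T)` is not comparable with `E₁²E₂` (the image sums may vanish).  So the kit's octave table must enclose the TAIL-AUGMENTED shape:
V3 = V2 with one more rational field `Tmax` and clause (ii′) = (ii) with `+ Tmax` inside both periodised factors (kit side: evaluate the enclosure at
`T = Tmax`, monotone — no extra cost).  The generic reader core `…ScaleZeroBetaWindowSiteSum.siteSum_sunsetShapeT_gridSum_le_of_octaveTable` reads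
exactly (ii′) + (iii) and delivers the grid rows for every `β′ ≥ klBetaMin` and every tail with `(β′/klBetaMin)·T ≤ Tmax`.  V2 stays as the `Tmax = 0`
special case (a valid format for a tail-free door); the reader targets V3. -/

/-- **The record of one μ-cell certificate, V3** = V2 + the tail allowance `Tmax` (all numbers rational; written by `gen_record.py`). -/
structure SunsetCellRecordV3 extends SunsetCellRecordV2 where
  /-- tail allowance: the reader needs `(β/klBetaMin)·(window tail + torus tail) ≤ Tmax`; the table (ii′) is certified with `+ Tmax` inside -/
  Tmax : ℚ

/-- **`ScaleZeroSunsetCertV3 c`** — what KIT JOB A certifies for the μ-cell record `c`: V2's (i) and (iii) verbatim, and (ii′) = the octave-table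
domination of the `Tmax`-AUGMENTED site-summed weighted sunset shapes `Σ_z w_k(z)·(Σ_m P z (β(s+m)) + Tmax)²·(Σ_m P(−z)(β(1−s+m)) + Tmax)`.
Octave parameters `K, N`, the table `tab` and the profiles `P` are existential (kit-internal). -/
def ScaleZeroSunsetCertV3 (c : SunsetCellRecordV3) : Prop :=
  ∃ (K N : ℕ) (tab : Fin 3 → ℕ → ℕ → ℝ≥0∞) (P : (Fin 2 → ℤ) → ℝ → ℝ≥0∞), 0 < K ∧ 0 < N ∧ (∀ z, Measurable (P z)) ∧
    -- (i) fattened profile domination of the β = ∞ off-site kernel, uniformly on the μ-cell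
    (∀ μ : ℝ, (c.μlo : ℝ) ≤ μ → μ ≤ c.μhi → ∀ z ∈ c.disk, ∀ t u : ℝ, |u - t| ≤ (2 : ℝ)⁻¹ ^ 10 →
      (‖((1 / (2 * π) : ℝ) : ℂ) * 𝓕 (fun om : ℝ => mFourierCoeff (Torus.descend
          (fun y : Momentum => uvSymbolFn 1 klE0 (frameLevel μ 0 ((2 * π) • y)) om) (uvSpatialSymbol_isLatticePeriodic 1 klE0 μ 0 om))
          (-z)) (u / (2 * π))‖₊ : ℝ≥0∞) ≤ P z t) ∧
    -- (ii′) octave-table domination of the Tmax-augmented site-summed weighted sunset shapes of the profiles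
    (∀ k : Fin 3, ∀ i : ℕ, i < K → ∀ j : ℕ, j < N → ∀ β : ℝ, klBetaMin * (1 + (i : ℝ) / K) ≤ β → β ≤ klBetaMin * (1 + ((i : ℝ) + 1) / K) →
      ∀ s : ℝ, (j : ℝ) / N < s → s ≤ ((j : ℝ) + 1) / N →
        ∑ z ∈ c.disk, SunsetCellRecordV2.siteWeight k z *
          (((∑' m : ℤ, P z (β * (s + m))) + ENNReal.ofReal (c.Tmax : ℝ)) ^ 2 *
            ((∑' m : ℤ, P (-z) (β * (1 - s + m))) + ENNReal.ofReal (c.Tmax : ℝ))) ≤ tab k i j) ∧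
    -- (iii) row totals
    (∀ k : Fin 3, ∀ i : ℕ, i < K →
      ENNReal.ofReal (klBetaMin * (1 + ((i : ℝ) + 1) / K)) * ∑ j ∈ Finset.range N, ENNReal.ofReal (1 / (N : ℝ)) * tab k i j ≤
        ENNReal.ofReal (c.row k : ℝ))

/-! ## §Far (appended, same seat — KL STATUS 2026-08-28 «(2e)-FAR-SITES», FAR-SITES-NOTE-g14 §4): the FAR-SITE certificate

The sites whose centred difference lies OUTSIDE the disk are read without profiles (time-grid Parseval + per-frequency spatial decay from the
momentum jets of the scale-0 symbol, `…FlowReadScaleZeroSunsetFarRows.farRows_le_of_jets`).  The only certified input is ONE momentum-jet ENVELOPE of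
the symbol, uniform on the μ-cell: `‖Dⁿ_y Ψ(1, klE0; e₀(2πy), ω)‖ ≤ Jn / max(|ω|, klE0/2)²` for every `ω ≠ 0` and every `y` (kit: Taylor-model AD of the
explicit symbol, two implementations; `n ≥ 4`, sized by a float pass together with the disk radius `Rc`). -/

/-- **The record of one μ-cell FAR certificate**: the cell, the jet order `n` and the envelope constant `Jn` (rationals / naturals, written by `gen_record.py`). -/
structure SunsetFarRecord where
  /-- the μ-cell `[μlo, μhi]` -/
  μlo : ℚ
  /-- the μ-cell `[μlo, μhi]` -/
  μhi : ℚ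
  /-- jet order (the reader needs `4 ≤ n`; the far rows decay like `(Rc+2)^{−(2n−4−k)}`) -/
  n : ℕ
  /-- envelope constant: `‖Dⁿ g_{μ,ω}‖ ≤ Jn / max(|ω|, klE0/2)²` -/
  Jn : ℚ

/-- **`ScaleZeroFarJetCert c`** — what the kit certifies for the far record `c`: `4 ≤ n` and the momentum-jet envelope of the scale-0 symbol
`g_{μ,ω}(y) = Ψ(1, klE0; e₀(2πy), ω)` (`…TorusPeriodisation.norm_torusFourierInv_uvSpatialSample_le_inv_pow_offSite`'s hypothesis `hD`, with the
`1/ω²` frequency shape that sums over the Matsubara window uniformly in β), uniformly on the μ-cell. -/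
def ScaleZeroFarJetCert (c : SunsetFarRecord) : Prop :=
  2 * 2 ≤ c.n ∧ ∀ μ : ℝ, (c.μlo : ℝ) ≤ μ → μ ≤ c.μhi → ∀ om : ℝ, om ≠ 0 → ∀ y : Momentum,
    ‖iteratedFDeriv ℝ c.n (fun y : Momentum => uvSymbolFn 1 klE0 (frameLevel μ 0 ((2 * π) • y)) om) y‖ ≤ (c.Jn : ℝ) / max |om| (klE0 / 2) ^ 2

end Summit.HubbardSuperconductivity.HubbardSuperconductivity.Theorems.KLRegimeSplit

end
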